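import Literature.NumberTheory.DiophantineGeometry.FunctionFieldAdelesProofs
import HarnessLib

/-!
# The genus bound `2g ≤ (d - 1)(d - 2)` for a function field with a plane model of degree `d`

Library file continuing the function-field chain `FunctionFieldDivisors` … `FunctionFieldAdelesProofs`
(places, divisors, `ℒ(D)`, `ℓ(D)`, the genus, Riemann–Roch). It proves the classical bound on the
genus of (the function field of) a plane curve of degree `d`, in the abstract form in which it is
used for the existence of rational points on absolutely irreducible plane curves over finite fields
(Cafure–Matera 2006, Thm. 5.4, via Weil's estimate (1), which uses `2g ≤ (δ-1)(δ-2)`):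

* `two_mul_genus_le_of_planeModel`: let `F/K` be an algebraic function field of one variable with
  full constant field `K`, `x ∈ F` transcendental with `[F : K(x)] = d`, and `y ∈ ℒ((x)_∞)` such that
  the monomials `xⁱ yʲ` (`j < d`) are linearly independent over `K`. Then `2g ≤ (d - 1)(d - 2)`.

This is the situation of an affine plane curve `Φ(x, y) = 0` with `Φ` of total degree `d` and monic
of degree `d` in `y`: then `y/x` is integral over `K[1/x]`, i.e. `y ∈ ℒ((x)_∞)`, and
`1, y, …, y^{d-1}` is a `K(x)`-basis of `F`.

## Proof

With `A = (x)_∞` (`deg A = d`, Stichtenoth Thm. 1.4.11) the `d(m+1) - d(d-1)/2` monomials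
`xⁱ yʲ` with `i + j ≤ m`, `j < d` lie in `ℒ(mA)` and are `K`-linearly independent, so
`ℓ(mA) ≥ d(m+1) - d(d-1)/2`; for `m d > 2g - 2` Riemann–Roch (Stichtenoth Thm. 1.5.17,
`ell_eq_degree_add_one_sub_genus`) gives `ℓ(mA) = md + 1 - g`, whence
`g ≤ 1 - d + d(d-1)/2 = (d-1)(d-2)/2`. This is the standard Riemann–Roch proof of the genus
formula for plane curves, as an inequality (equality holds for nonsingular curves and is not
needed).

## References

* H. Stichtenoth, *Algebraic Function Fields and Codes*, 2nd ed., GTM 254, Springer 2009,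
  Thm. 1.4.11, Thm. 1.5.17. [Stichtenoth2009]
* A. Cafure, G. Matera, *Improved explicit estimates on the number of solutions of equations over a
  finite field*, Finite Fields Appl. 12 (2006) 155–185, §1 eq. (1) (`2g ≤ (δ-1)(δ-2)`) and Thm. 5.4.
  [CafureMatera2006]
-/

noncomputable section

open scoped IntermediateField

namespace Literature.NumberTheory.DiophantineGeometry.AlgFunctionField

universe u v

variable {K : Type u} {F : Type v} [Field K] [Field F] [Algebra K F]

/-- The arithmetic behind the triangle count: `2 ∑_{j<d} (m + 1 - j) + d(d-1) = 2d(m+1)` for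
`d ≤ m + 1` (natural subtraction is exact in this range). [folklore] -/
theorem two_mul_sum_range_sub_add (d m : ℕ) (hdm : d ≤ m + 1) :
    2 * ∑ j ∈ Finset.range d, (m + 1 - j) + d * (d - 1) = 2 * (d * (m + 1)) := by
  have h1 : ∑ j ∈ Finset.range d, (m + 1 - j) + ∑ j ∈ Finset.range d, j = d * (m + 1) := by
    rw [← Finset.sum_add_distrib]
    have : ∀ j ∈ Finset.range d, (m + 1 - j) + j = m + 1 := fun j hj ↦ by
      rw [Finset.mem_range] at hj
      omega
    rw [Finset.sum_congr rfl this, Finset.sum_const, Finset.card_range, smul_eq_mul]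
  have h2 : (∑ j ∈ Finset.range d, j) * 2 = d * (d - 1) := Finset.sum_range_id_mul_two d
  omega

/-- **Genus bound for a plane model of degree `d`: `2g ≤ (d-1)(d-2)`.** Let `F/K` be an algebraic
function field of one variable with full constant field `K`, `x ∈ F` transcendental over `K` with
`[F : K(x)] = d`, and `y ∈ ℒ((x)_∞)` (poles of `y` only at poles of `x`, to at most the same order)
such that for every `l` the monomials `xⁱ yʲ` (`i ≤ l`, `j < d`) are linearly independent over `K`
(equivalently `1, y, …, y^{d-1}` are linearly independent over `K(x)`). Then `2 g ≤ (d-1)(d-2)`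
where `g` is the genus of `F/K`. Proof: the monomials `xⁱ yʲ` with `i + j ≤ m`, `j < d` lie in
`ℒ(m (x)_∞)`, so `ℓ(m (x)_∞) ≥ d(m+1) - d(d-1)/2`, and `ℓ(m (x)_∞) = md + 1 - g` for `m` large by
Riemann–Roch (Stichtenoth Thm. 1.4.11 for `deg (x)_∞ = d`, Thm. 1.5.17).
[cite: Stichtenoth2009, Thm. 1.4.11 and Thm. 1.5.17] -/
theorem two_mul_genus_le_of_planeModel [IsAlgFunctionField K F] [IsIntegrallyClosedIn K F]
    {x y : F} (hx : Transcendental K x) {d : ℕ} (hd : Module.finrank K⟮x⟯ F = d)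
    (hy : y ∈ riemannRochSpace (principalDivisor K x)⁻)
    (hli : ∀ l : ℕ, LinearIndependent K
      fun ij : Fin (l + 1) × Fin d ↦ x ^ (ij.1 : ℕ) * y ^ (ij.2 : ℕ)) :
    2 * genus K F ≤ (d - 1) * (d - 2) := by
  classical
  have hx0 : x ≠ 0 := fun h ↦ hx (h ▸ isAlgebraic_zero)
  haveI := IsAlgFunctionField.finiteDimensional_adjoin_simple hx
  -- `d ≥ 1`
  have hd1 : 1 ≤ d := by
    rw [← hd]
    exact Module.finrank_pos
  set A : Divisor K F := (principalDivisor K x)⁻ with hA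
  have hA0 : 0 ≤ A := negPart_nonneg _
  have hdegA : A.degree = d := by
    rw [hA, degree_negPart_principalDivisor_eq hx, hd]
  have hxA : x ∈ riemannRochSpace A := mem_riemannRochSpace_negPart_principalDivisor hx0
  set g : ℕ := genus K F with hg
  -- the multiple `m A` used
  set m : ℕ := 2 * g + d with hm
  have hdm : d ≤ m + 1 := by omega
  haveI := finiteDimensional_riemannRochSpace_of_isAlgFunctionField (K := K) (m • A)
  -- the triangle family `xⁱ yʲ`, `j < d`, `i ≤ m - j`
  let ι : Type := Σ j : Fin d, Fin (m + 1 - j)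
  let e : ι → Fin (m + 1) × Fin d := fun ji ↦ (⟨ji.2, by have := ji.2.2; omega⟩, ji.1)
  have he : Function.Injective e := by
    rintro ⟨j, i⟩ ⟨j', i'⟩ h
    simp only [e, Prod.mk.injEq, Fin.mk.injEq] at h
    obtain ⟨hi, rfl⟩ := h
    congr 1
    exact Fin.ext hi
  have hmem : ∀ ji : ι, x ^ ((e ji).1 : ℕ) * y ^ ((e ji).2 : ℕ) ∈ riemannRochSpace (m • A) := by
    rintro ⟨j, i⟩
    have hij : (i : ℕ) + j ≤ m := by have := i.2; omega
    have h1 : x ^ (i : ℕ) * y ^ (j : ℕ) ∈ riemannRochSpace ((i : ℕ) • A + (j : ℕ) • A) :=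
      mul_mem_riemannRochSpace_add (pow_mem_riemannRochSpace_nsmul hxA i)
        (pow_mem_riemannRochSpace_nsmul hy j)
    have hle : (i : ℕ) • A + (j : ℕ) • A ≤ m • A := by
      rw [← add_nsmul]
      exact nsmul_le_nsmul_left hA0 hij
    exact riemannRochSpace_mono hle h1
  have hliι : LinearIndependent K fun ji : ι ↦ x ^ ((e ji).1 : ℕ) * y ^ ((e ji).2 : ℕ) :=
    (hli m).comp e he
  have hli' : LinearIndependent K fun ji : ι ↦
      (⟨x ^ ((e ji).1 : ℕ) * y ^ ((e ji).2 : ℕ), hmem ji⟩ : riemannRochSpace (m • A)) :=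
    LinearIndependent.of_comp (riemannRochSpace (m • A)).subtype hliι
  have hcard := hli'.fintype_card_le_finrank
  have hcardι : Fintype.card ι = ∑ j ∈ Finset.range d, (m + 1 - j) := by
    simp only [ι, Fintype.card_sigma, Fintype.card_fin]
    exact Fin.sum_univ_eq_sum_range (fun j ↦ m + 1 - j) d
  -- so `∑_{j<d} (m+1-j) ≤ ℓ(mA)`
  have hell : ∑ j ∈ Finset.range d, (m + 1 - j) ≤ ell (m • A) := by
    rw [← hcardι]
    exact hcard
  -- Riemann–Roch for `m A`: `deg (mA) = m d > 2g - 2`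
  have hdegmA : (m • A).degree = (m : ℤ) * d := by
    rw [map_nsmul, hdegA, nsmul_eq_mul]
  have hlt : 2 * (genus K F : ℤ) - 2 < (m • A).degree := by
    rw [hdegmA, hm]
    push_cast
    nlinarith
  have hRR := ell_eq_degree_add_one_sub_genus (K := K) (F := F) hlt
  rw [hdegmA] at hRR
  -- arithmetic
  have hsum := two_mul_sum_range_sub_add d m hdm
  have hell' : (2 * ∑ j ∈ Finset.range d, (m + 1 - j) : ℕ) ≤ 2 * ell (m • A) :=
    Nat.mul_le_mul_left 2 hell
  have hineq : 2 * (d * (m + 1)) ≤ 2 * ell (m • A) + d * (d - 1) := by omega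
  have hineqZ : (2 * ((d : ℤ) * (m + 1)) : ℤ) ≤ 2 * (ell (m • A) : ℤ) + d * ((d : ℤ) - 1) := by
    have h := (Nat.cast_le (α := ℤ)).2 hineq
    push_cast [Nat.cast_sub hd1] at h
    linarith
  have key : 2 * (g : ℤ) ≤ ((d : ℤ) - 1) * ((d : ℤ) - 2) := by
    rw [← hg] at hRR
    nlinarith
  rcases Nat.lt_or_ge d 2 with hd2 | hd2
  · have : d = 1 := by omega
    subst this
    simp only [Nat.cast_one, sub_self, zero_mul] at key
    have : g = 0 := by omega
    omega
  · have h2 : ((d - 1 : ℕ) : ℤ) = (d : ℤ) - 1 := by push_cast [Nat.cast_sub hd1]; ring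
    have h3 : ((d - 2 : ℕ) : ℤ) = (d : ℤ) - 2 := by push_cast [Nat.cast_sub hd2]; ring
    have : (2 * g : ℤ) ≤ ((d - 1 : ℕ) : ℤ) * ((d - 2 : ℕ) : ℤ) := by rw [h2, h3]; exact key
    exact_mod_cast this

end Literature.NumberTheory.DiophantineGeometry.AlgFunctionField
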